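import Literature.Barriers.QuantumAdvantage.NoFreeFrameGaussianBound
import Literature.Computability.QuantumComplexity.DecisionDiagrams
import HarnessLib

/-!
# `gaussianDegreeBound` holds: matchgate (fermionic Gaussian) frames do not compress the initial blocks of a flat state

Barrier catalogue `Literature/Barriers/QuantumAdvantage/` (D-0021). Proofs only (no definitions, no
named facts): the discharge of the named fact `Literature.Barriers.QuantumAdvantage.gaussianDegreeBound`
of `NoFreeFrameGaussianBound.lean`: for a unit `ε`-flat vector `ψ` on `n` qubits (`|⟨ψ|S|ψ⟩| ≤ ε` for
every Pauli string `S ≠ I`), every unitary `U` that is fermionic Gaussian in the tree's Jordan–Wigner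
frame (`U c_p U† = Σ_q R_{pq} c_q`, `R Rᵀ = 1`, `c = majorana`) and every `d ≤ n`, the purity of the
first `d` qubits of `Uψ` (the four-fold agreement sum) is at most `2^{-d} (1 + ε² Σ_{k=1}^{2d} C(2n,k))`.

Proof (filtration + Bessel; no compound matrices): (1) purity = spectral mass,
`‖Σ⁽⁴⁾‖ = 2^{-d} Σ_{S ∈ 𝒫^{<d}⊗I} |⟨Uψ|S|Uψ⟩|²` and `⟨Uψ|S|Uψ⟩ = ⟨ψ|U†SU|ψ⟩`; (2) Jordan–Wigner keeps
initial blocks local: each such `S` is a unit phase times a Majorana WORD of length `≤ 2d`; (3)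
`U† c_q U = Σ_p R_{pq} c_p`, so `U†` maps words of length `m` into the span of words of length `m`,
and every word is a unit phase times the Pauli string of the set of its odd-multiplicity letters, so
all `U† S U` lie in the span of strings `σ_T`, `T` ranging over a set `𝒯` with
`|𝒯 ∖ {I}| ≤ Σ_{k=1}^{2d} C(2n,k)`; (4) Hilbert–Schmidt orthogonality and Bessel for `A ↦ ⟨ψ|A|ψ⟩` give
`Σ_S |⟨ψ|U†SU|ψ⟩|² ≤ Σ_{T ∈ 𝒯} |⟨ψ|σ_T|ψ⟩|² ≤ 1 + ε² |𝒯 ∖ {I}|`.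

PROVENANCE. The barrier docstring of `gaussianDegreeBound` records that this statement was
machine-checked in the tree as
`Summit.QuantumAdvantage.QuantumAdvantage.Theorems.SymplecticPurity.GaussianDegreeBound_proof` (item
stmt-QuantumAdvantage-9838 of the retired route `SymplecticPurity`), with a body definitionally equal
to the Literature `def`; `Literature` cannot import `Summits`, so the proof — the four files
`Summits/QuantumAdvantage/QuantumAdvantage/Theorems/SymplecticPurityGaussianDegreeBound{Words,Bessel,SpectralMass,}.lean`,
which use only Mathlib and `Literature.Computability.QuantumComplexity.{GaussianRank, DecisionDiagrams}` —
is carried over here verbatim, one `section` per source file, as private helper lemmas in the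
sub-namespace `…QuantumAdvantage.GaussianDegreeBound`, and closed as `gaussianDegreeBound_holds`.

## References

* [JozsaMiyake2008] R. Jozsa, A. Miyake, *Matchgates and classical simulation of quantum circuits*,
  Proc. R. Soc. A 464 (2008), 3089–3106.
-/

noncomputable section

namespace Literature.Barriers.QuantumAdvantage

open Matrix Finset
open scoped InnerProductSpace
open Literature.Computability.QuantumComplexity Literature.Computability.Cryptography

namespace GaussianDegreeBound

section Words

/-! ### Source `SymplecticPurityGaussianDegreeBoundWords.lean` — Jordan–Wigner words: low Pauli strings are unit phases times short Majorana words

Original module docstring: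

# `SymplecticPurity.GaussianDegreeBound` (stmt-QuantumAdvantage-9838) — I: Jordan–Wigner words

Helper file (prover, `--supports stmt-QuantumAdvantage-9838`) for the support item
`GaussianDegreeBound` of route SymplecticPurity (purity of an initial block of `d` qubits after a
fermionic Gaussian unitary applied to an `ε`-flat state).  This file is the PAULI-ALGEBRA part of
the proof, over the tree's Jordan–Wigner Majoranas `majorana n j b` (`GaussianRank.lean`) and the
product table of Pauli strings (`pauliString_mul`, `DecisionDiagrams.lean`):

* `exists_word_of_low` — every Pauli string supported on the wires `< d` is a unit phase times an
  ORDERED PRODUCT (a *word*) of at most `2d` Majoranas (`X_j = Z_{<j} c_{j,X}`,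
  `Y_j = Z_{<j} c_{j,Y}`, `Z_j = -i c_{j,X} c_{j,Y}`; induction on `d`, absorbing the `Z`-tail into
  the lower string before the induction hypothesis is applied);
* `word_eq_smul_pauliString` — every Majorana word (repetitions allowed) is a unit phase times the
  Pauli string whose `𝔽₂`-symplectic bits are the SUM of the bits of its letters' Jordan–Wigner
  words (strings form a group modulo phases);
* `exists_finset_sum_eq_list_sum` — in characteristic two a list sum is a sum over a set of at
  most `length` elements (so a word of length `≤ 2d` has the string of a SET of `≤ 2d` modes);
* `card_image_erase_le` — hence the strings of all words of length `≤ 2d` on `n` qubits, the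
  identity excluded, number at most `Σ_{k=1}^{2d} C(2n, k)`.

No auxiliary definitions: the bit encoding `β : Pauli → ZMod 2 × ZMod 2` and its inverse `π` are
universally quantified and pinned down by hypotheses (instantiated by explicit tables in the main
file `SymplecticPurityGaussianDegreeBound.lean`).
-/


open Matrix Finset
open Literature.Computability.QuantumComplexity Literature.Computability.Cryptography

/-! ### The product table: neutral letter and unit phases -/

/-- `I` is a right unit of the letter product. [folklore] -/
private theorem letterMul_I_right (P : Pauli) : P.letterMul Pauli.I = P := by
  cases P <;> rfl

/-- `I` is a left unit of the letter product. [folklore] -/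
private theorem letterMul_I_left (P : Pauli) : Pauli.I.letterMul P = P := by
  cases P <;> rfl

/-- Products with `I` on the right carry no phase. [folklore] -/
private theorem letterPhase_I_right (P : Pauli) : P.letterPhase Pauli.I = 1 := by
  cases P <;> rfl

/-- Products with `I` on the left carry no phase. [folklore] -/
private theorem letterPhase_I_left (P : Pauli) : Pauli.I.letterPhase P = 1 := by
  cases P <;> rfl

/-- The phases of the letter product table are unit complex numbers. [folklore] -/
private theorem norm_letterPhase (P Q : Pauli) : ‖P.letterPhase Q‖ = 1 := by
  cases P <;> cases Q <;> simp [Pauli.letterPhase]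

/-- The phase of a product of two Pauli strings is a unit complex number. [folklore] -/
private theorem norm_stringPhase {ι : Type*} [Fintype ι] (P Q : ι → Pauli) : ‖stringPhase P Q‖ = 1 := by
  rw [stringPhase, norm_prod]
  exact Finset.prod_eq_one fun i _ => norm_letterPhase _ _

/-! ### One-wire factors as Majorana words -/

variable {n : ℕ}

/-- Splitting off the letter on wire `j`: `σ_S = σ_{S[j ↦ I]} · σ_{I…I S_j I…I}` (no phase). [folklore] -/
private theorem pauliString_eq_update_mul_single (S : Fin n → Pauli) (j : Fin n) :
    pauliString S = pauliString (Function.update S j Pauli.I) *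
      pauliString (Function.update (fun _ => Pauli.I) j (S j)) := by
  rw [pauliString_mul]
  have h1 : stringMul (Function.update S j Pauli.I) (Function.update (fun _ => Pauli.I) j (S j)) = S := by
    funext i
    by_cases hi : i = j
    · subst hi
      simp [stringMul, letterMul_I_left]
    · simp [stringMul, hi, letterMul_I_right]
  have h2 : stringPhase (Function.update S j Pauli.I) (Function.update (fun _ => Pauli.I) j (S j)) = 1 := by
    refine Finset.prod_eq_one fun i _ => ?_
    by_cases hi : i = j
    · subst hi
      simp [letterPhase_I_left]
    · simp [hi, letterPhase_I_right]
  rw [h1, h2, one_smul]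

/-- `X_j = Z_{<j} · c_{j,X}` and `Y_j = Z_{<j} · c_{j,Y}`: the single-site `X`/`Y` is the `Z`-tail
string below `j` times the Jordan–Wigner Majorana.
[folklore] -/
private theorem pauliString_single_XY (j : Fin n) (b : Bool) :
    pauliString (Function.update (fun _ => Pauli.I) j (if b then Pauli.Y else Pauli.X)) =
      pauliString (fun i : Fin n => if i < j then Pauli.Z else Pauli.I) * majorana n j b := by
  rw [majorana, pauliString_mul]
  have h1 : stringMul (fun i : Fin n => if i < j then Pauli.Z else Pauli.I) (majoranaWord n j b) =
      Function.update (fun _ => Pauli.I) j (if b then Pauli.Y else Pauli.X) := by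
    funext i
    rcases lt_trichotomy i j with h | rfl | h
    · rw [Function.update_of_ne (ne_of_lt h)]
      simp only [stringMul, if_pos h, majoranaWord_of_lt n b h]
      rfl
    · rw [Function.update_self]
      simp only [stringMul, lt_irrefl, if_false, majoranaWord_self]
      cases b <;> rfl
    · rw [Function.update_of_ne (ne_of_gt h)]
      simp only [stringMul, if_neg (not_lt.2 h.le), majoranaWord_of_gt n b h]
      rfl
  have h2 : stringPhase (fun i : Fin n => if i < j then Pauli.Z else Pauli.I) (majoranaWord n j b) = 1 := by
    refine Finset.prod_eq_one fun i _ => ?_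
    rcases lt_trichotomy i j with h | rfl | h
    · simp only [if_pos h, majoranaWord_of_lt n b h]
      rfl
    · simp only [lt_irrefl, if_false, majoranaWord_self]
      cases b <;> rfl
    · simp only [if_neg (not_lt.2 h.le), majoranaWord_of_gt n b h]
      rfl
  rw [h1, h2, one_smul]

/-- `c_{j,X} c_{j,Y} = i Z_j`. [folklore] -/
private theorem majorana_false_mul_true (j : Fin n) :
    majorana n j false * majorana n j true =
      Complex.I • pauliString (Function.update (fun _ => Pauli.I) j Pauli.Z) := by
  rw [majorana, majorana, pauliString_mul]
  have h1 : stringMul (majoranaWord n j false) (majoranaWord n j true) =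
      Function.update (fun _ => Pauli.I) j Pauli.Z := by
    funext i
    rcases lt_trichotomy i j with h | rfl | h
    · rw [Function.update_of_ne (ne_of_lt h)]
      simp only [stringMul, majoranaWord_of_lt n _ h]
      rfl
    · rw [Function.update_self]
      simp only [stringMul, majoranaWord_self]
      rfl
    · rw [Function.update_of_ne (ne_of_gt h)]
      simp only [stringMul, majoranaWord_of_gt n _ h]
      rfl
  have h2 : stringPhase (majoranaWord n j false) (majoranaWord n j true) = Complex.I := by
    rw [stringPhase, Finset.prod_eq_single j]
    · simp only [majoranaWord_self]
      rfl
    · intro i _ hi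
      rcases lt_or_gt_of_ne hi with h | h
      · simp only [majoranaWord_of_lt n _ h]
        rfl
      · simp only [majoranaWord_of_gt n _ h]
        rfl
    · simp
  rw [h1, h2]

/-- `Z_j = -i c_{j,X} c_{j,Y}`. [folklore] -/
private theorem pauliString_single_Z (j : Fin n) :
    pauliString (Function.update (fun _ => Pauli.I) j Pauli.Z) =
      (-Complex.I) • (majorana n j false * majorana n j true) := by
  rw [majorana_false_mul_true, smul_smul]
  simp

/-! ### Strings on the low wires are short Majorana words -/

/-- The word product of a concatenation. [folklore] -/
private theorem word_append (w w' : List (Fin n × Bool)) :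
    ((w ++ w').map fun q => majorana n q.1 q.2).prod =
      (w.map fun q => majorana n q.1 q.2).prod * (w'.map fun q => majorana n q.1 q.2).prod := by
  rw [List.map_append, List.prod_append]

/-- **Jordan–Wigner keeps initial blocks local**: a Pauli string supported on the wires `< d` is a
unit phase times a Majorana word of length `≤ 2d` (all of whose letters live on wires `< d`, which
we do not record). Induction on `d`: split off the top letter `σ` on wire `j = d`; `I`: nothing;
`X`/`Y`: `σ_j = Z_{<j} c_{j,σ}` and `Z_{<j}` is absorbed into the lower string (a string on wires
`< d`, up to a phase) BEFORE the induction hypothesis; `Z`: `Z_j = -i c_{j,X} c_{j,Y}`.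
[folklore] -/
private theorem exists_word_of_low {d : ℕ} (hd : d ≤ n) :
    ∀ S : Fin n → Pauli, (∀ i : Fin n, d ≤ i.val → S i = Pauli.I) →
      ∃ (w : List (Fin n × Bool)) (c : ℂ), w.length ≤ 2 * d ∧ ‖c‖ = 1 ∧
        pauliString S = c • (w.map fun q => majorana n q.1 q.2).prod := by
  induction d with
  | zero =>
    intro S hS
    refine ⟨[], 1, le_rfl, norm_one, ?_⟩
    have : S = fun _ => Pauli.I := funext fun i => hS i (Nat.zero_le _)
    rw [this, pauliString_const_I, one_smul, List.map_nil, List.prod_nil]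
  | succ d ih =>
    intro S hS
    have hdn : d < n := hd
    set j : Fin n := ⟨d, hdn⟩ with hj
    have ih' := ih hdn.le
    -- the lower string
    have hlow : ∀ i : Fin n, d ≤ i.val → Function.update S j Pauli.I i = Pauli.I := by
      intro i hi
      by_cases hij : i = j
      · rw [hij, Function.update_self]
      · rw [Function.update_of_ne hij]
        refine hS i ?_
        have : i.val ≠ d := fun h => hij (Fin.ext (by rw [h, hj]))
        omega
    have hsplit := pauliString_eq_update_mul_single S j
    rcases hSj : S j with _ | _ | _ | _
    · -- `I`: the string is already low
      have hself : Function.update S j Pauli.I = S := by rw [← hSj, Function.update_eq_self]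
      obtain ⟨w, c, hw, hc, h⟩ := ih' S (by rw [← hself]; exact hlow)
      exact ⟨w, c, by omega, hc, h⟩
    · -- `X`
      have hZlow : ∀ i : Fin n, d ≤ i.val →
          stringMul (Function.update S j Pauli.I) (fun i : Fin n => if i < j then Pauli.Z else Pauli.I) i
            = Pauli.I := by
        intro i hi
        have hij : ¬ i < j := fun h => by
          have h' : i.val < d := Fin.lt_def.1 h
          omega
        simp only [stringMul, hlow i hi, if_neg hij]
        rfl
      obtain ⟨w, c, hw, hc, h⟩ := ih' _ hZlow
      refine ⟨w ++ [(j, false)], stringPhase (Function.update S j Pauli.I)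
        (fun i : Fin n => if i < j then Pauli.Z else Pauli.I) * c, ?_, ?_, ?_⟩
      · rw [List.length_append, List.length_singleton]; omega
      · rw [norm_mul, norm_stringPhase, hc, one_mul]
      · rw [hsplit, hSj, show (Pauli.X : Pauli) = if false then Pauli.Y else Pauli.X from rfl,
          pauliString_single_XY, ← Matrix.mul_assoc, pauliString_mul, h, word_append,
          List.map_singleton, List.prod_singleton, Matrix.smul_mul, Matrix.smul_mul, smul_smul]
    · -- `Y`
      have hZlow : ∀ i : Fin n, d ≤ i.val →
          stringMul (Function.update S j Pauli.I) (fun i : Fin n => if i < j then Pauli.Z else Pauli.I) i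
            = Pauli.I := by
        intro i hi
        have hij : ¬ i < j := fun h => by
          have h' : i.val < d := Fin.lt_def.1 h
          omega
        simp only [stringMul, hlow i hi, if_neg hij]
        rfl
      obtain ⟨w, c, hw, hc, h⟩ := ih' _ hZlow
      refine ⟨w ++ [(j, true)], stringPhase (Function.update S j Pauli.I)
        (fun i : Fin n => if i < j then Pauli.Z else Pauli.I) * c, ?_, ?_, ?_⟩
      · rw [List.length_append, List.length_singleton]; omega
      · rw [norm_mul, norm_stringPhase, hc, one_mul]
      · rw [hsplit, hSj, show (Pauli.Y : Pauli) = if true then Pauli.Y else Pauli.X from rfl,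
          pauliString_single_XY, ← Matrix.mul_assoc, pauliString_mul, h, word_append,
          List.map_singleton, List.prod_singleton, Matrix.smul_mul, Matrix.smul_mul, smul_smul]
    · -- `Z`
      obtain ⟨w, c, hw, hc, h⟩ := ih' _ hlow
      refine ⟨w ++ [(j, false), (j, true)], c * (-Complex.I), ?_, ?_, ?_⟩
      · rw [List.length_append]; simp only [List.length_cons, List.length_nil]; omega
      · rw [norm_mul, hc, norm_neg, Complex.norm_I, one_mul]
      · rw [hsplit, hSj, pauliString_single_Z, h, word_append, Matrix.smul_mul, Matrix.mul_smul,
          smul_smul]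
        simp only [List.map_cons, List.map_nil, List.prod_cons, List.prod_nil, Matrix.mul_one]

/-! ### Words are phased Pauli strings (strings form a group modulo phases) -/

section Bits

variable (β : Pauli → ZMod 2 × ZMod 2) (π : ZMod 2 × ZMod 2 → Pauli)
  (hπβ : ∀ P, π (β P) = P) (hβπ : ∀ v, β (π v) = v)
  (hmul : ∀ P Q : Pauli, β (P.letterMul Q) = β P + β Q) (hI : β Pauli.I = 0)

include hπβ hβπ hmul in
/-- The letter product read through the bit encoding. [folklore] -/
private theorem letterMul_pi (P : Pauli) (v : ZMod 2 × ZMod 2) : P.letterMul (π v) = π (β P + v) := by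
  conv_lhs => rw [← hπβ (P.letterMul (π v)), hmul, hβπ]

include hπβ hβπ hmul hI in
/-- **Every Majorana word is a phased Pauli string** whose bits are the sum of the bits of the
Jordan–Wigner words of its letters: `c_{q₁} ⋯ c_{q_m} = c · σ_{π(Σ_k β(w_{q_k}))}`, `|c| = 1`.
[folklore] -/
private theorem word_eq_smul_pauliString (w : List (Fin n × Bool)) :
    ∃ c : ℂ, ‖c‖ = 1 ∧ (w.map fun q => majorana n q.1 q.2).prod =
      c • pauliString (fun i => π ((w.map fun q => fun i => β (majoranaWord n q.1 q.2 i)).sum i)) := by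
  induction w with
  | nil =>
    refine ⟨1, norm_one, ?_⟩
    have h0 : π 0 = Pauli.I := by rw [← hI, hπβ]
    simp only [List.map_nil, List.prod_nil, List.sum_nil, Pi.zero_apply, h0, pauliString_const_I,
      one_smul]
  | cons q w ih =>
    obtain ⟨c, hc, h⟩ := ih
    refine ⟨c * stringPhase (majoranaWord n q.1 q.2)
      (fun i => π ((w.map fun q => fun i => β (majoranaWord n q.1 q.2 i)).sum i)), ?_, ?_⟩
    · rw [norm_mul, hc, norm_stringPhase, one_mul]
    · rw [List.map_cons, List.prod_cons, h, Matrix.mul_smul, majorana, pauliString_mul, smul_smul]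
      congr 2
      funext i
      simp only [stringMul, List.map_cons, List.sum_cons, Pi.add_apply]
      exact letterMul_pi β π hπβ hβπ hmul _ _

end Bits

/-- **List sums in characteristic two are sums over small sets**: if `x + x = 0` for all `x`, then
for every list `l` there is a set `T` of at most `|l|` elements (the elements of odd multiplicity)
with `Σ_{a ∈ l} f a = Σ_{a ∈ T} f a` for EVERY `f`.
[folklore] -/
private theorem exists_finset_sum_eq_list_sum {α M : Type*} [DecidableEq α] [AddCommMonoid M]
    (h2 : ∀ x : M, x + x = 0) :
    ∀ l : List α, ∃ T : Finset α, T.card ≤ l.length ∧ ∀ f : α → M, (l.map f).sum = ∑ a ∈ T, f a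
  | [] => ⟨∅, le_rfl, fun f => by simp⟩
  | a :: l => by
    obtain ⟨T, hT, hsum⟩ := exists_finset_sum_eq_list_sum h2 l
    by_cases ha : a ∈ T
    · refine ⟨T.erase a, ?_, fun f => ?_⟩
      · have := Finset.card_erase_lt_of_mem ha
        rw [List.length_cons]
        omega
      · rw [List.map_cons, List.sum_cons, hsum f, ← Finset.add_sum_erase T f ha, ← add_assoc, h2,
          zero_add]
    · refine ⟨insert a T, ?_, fun f => ?_⟩
      · rw [Finset.card_insert_of_notMem ha, List.length_cons]
        omega
      · rw [List.map_cons, List.sum_cons, hsum f, Finset.sum_insert ha]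

/-! ### Counting the strings of short words -/

/-- The number of sets of Majorana modes of size between `1` and `m` on `n` qubits is at most
`Σ_{k=1}^{m} C(2n, k)`.
[folklore] -/
private theorem card_filter_card_mem_Icc_le (n m : ℕ) :
    ((Finset.univ : Finset (Finset (Fin n × Bool))).filter
        (fun T => 1 ≤ T.card ∧ T.card ≤ m)).card ≤
      ∑ k ∈ Finset.Icc 1 m, (2 * n).choose k := by
  classical
  have hsub : (Finset.univ : Finset (Finset (Fin n × Bool))).filter (fun T => 1 ≤ T.card ∧ T.card ≤ m) ⊆
      (Finset.Icc 1 m).biUnion (fun k => Finset.powersetCard k (Finset.univ : Finset (Fin n × Bool))) := by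
    intro T hT
    rw [Finset.mem_filter] at hT
    rw [Finset.mem_biUnion]
    exact ⟨T.card, Finset.mem_Icc.2 hT.2, Finset.mem_powersetCard.2 ⟨Finset.subset_univ _, rfl⟩⟩
  refine (Finset.card_le_card hsub).trans (Finset.card_biUnion_le.trans (le_of_eq ?_))
  refine Finset.sum_congr rfl fun k _ => ?_
  rw [Finset.card_powersetCard, Finset.card_univ, Fintype.card_prod, Fintype.card_fin,
    Fintype.card_bool, mul_comm]

/-- **Counting**: for any map `G` from sets of modes to strings, the images of the sets of size
`≤ m`, with the image of `∅` removed, number at most `Σ_{k=1}^{m} C(2n, k)`.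
[folklore] -/
private theorem card_image_erase_le (n m : ℕ) (G : Finset (Fin n × Bool) → (Fin n → Pauli)) :
    ((((Finset.univ : Finset (Finset (Fin n × Bool))).filter (fun T => T.card ≤ m)).image G).erase
        (G ∅)).card ≤
      ∑ k ∈ Finset.Icc 1 m, (2 * n).choose k := by
  classical
  refine le_trans (Finset.card_le_card ?_)
    ((Finset.card_image_le (f := G)).trans (card_filter_card_mem_Icc_le n m))
  intro S hS
  rw [Finset.mem_erase, Finset.mem_image] at hS
  obtain ⟨hne, T, hT, rfl⟩ := hS
  rw [Finset.mem_filter] at hT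
  refine Finset.mem_image.2 ⟨T, Finset.mem_filter.2 ⟨Finset.mem_univ _, ?_, hT.2⟩, rfl⟩
  rw [Nat.one_le_iff_ne_zero]
  intro h0
  exact hne (by rw [Finset.card_eq_zero.1 h0])


end Words

section Bessel

/-! ### Source `SymplecticPurityGaussianDegreeBoundBessel.lean` — conjugation by a Gaussian unitary preserves word length; Bessel for the expectation functional

Original module docstring:

# `SymplecticPurity.GaussianDegreeBound` (stmt-QuantumAdvantage-9838) — II: Gaussian action and Bessel

Helper file (prover, `--supports stmt-QuantumAdvantage-9838`) for the support item
`GaussianDegreeBound` of route SymplecticPurity.  Two independent ingredients: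

* GAUSSIAN ACTION ON WORDS.  From `U c_p U† = Σ_q R_{pq} c_q` with `R Rᵀ = 1` (so `Rᵀ R = 1`):
  `U† c_q U = Σ_p R_{pq} c_p` (`star_mul_majorana_mul`), hence conjugation by `U†` maps every
  Majorana WORD `c_{q₁} ⋯ c_{q_m}` into the span of the words of the same length
  (`star_mul_word_mul_mem_span`) — no normal ordering, compound matrices or determinants are needed
  for the purity bound, only this filtration.
* BESSEL FOR A FUNCTIONAL.  In a complex inner product space, if `(u_i)` and `(b_k)` are finite
  orthogonal families with the same square norm `N > 0` and every `u_i` lies in the span of the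
  `b_k`, then `Σ_i |f(u_i)|² ≤ Σ_k |f(b_k)|²` for every linear functional `f`
  (`sum_norm_sq_le_of_mem_span`: Riesz representer of `f` on the span + Bessel's inequality).
* The Hilbert–Schmidt pairing of matrices read through ANY coordinate map `Φ` into
  `EuclideanSpace ℂ (m × m)` (`inner_eq_trace_of_apply`), and the two orthogonality relations it
  is applied to: Pauli strings, and Pauli strings conjugated by a unitary (both `2ⁿ δ`).
-/


open Matrix Finset
open scoped InnerProductSpace
open Literature.Computability.QuantumComplexity Literature.Computability.Cryptography

/-! ### The Gaussian action on Majoranas and on words -/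

variable {n : ℕ}

/-- Conjugating back through a unitary: `U† (U M U†) U = M`. [folklore] -/
private theorem star_mul_conj_mul_eq {U : Matrix (QReg n) (QReg n) ℂ}
    (hU : U ∈ Matrix.unitaryGroup (QReg n) ℂ) (M : Matrix (QReg n) (QReg n) ℂ) :
    star U * (U * M * star U) * U = M := by
  have h1 : star U * U = 1 := Unitary.star_mul_self_of_mem hU
  calc star U * (U * M * star U) * U = (star U * U) * M * (star U * U) := by
        simp only [Matrix.mul_assoc]
    _ = M := by rw [h1, Matrix.one_mul, Matrix.mul_one]

/-- **The inverse rotation**: if `U c_p U† = Σ_q R_{pq} c_q` for all `p` with `R Rᵀ = 1`, then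
`U† c_q U = Σ_p R_{pq} c_p` for all `q` (`Rᵀ R = 1` for a square matrix).
[folklore] -/
private theorem star_mul_majorana_mul {U : Matrix (QReg n) (QReg n) ℂ}
    (hU : U ∈ Matrix.unitaryGroup (QReg n) ℂ) {R : Matrix (Fin n × Bool) (Fin n × Bool) ℝ}
    (hR : R * Rᵀ = 1)
    (hG : ∀ p : Fin n × Bool, U * majorana n p.1 p.2 * star U =
      ∑ q : Fin n × Bool, (R p q : ℂ) • majorana n q.1 q.2)
    (q : Fin n × Bool) :
    star U * majorana n q.1 q.2 * U = ∑ p : Fin n × Bool, (R p q : ℂ) • majorana n p.1 p.2 := by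
  have hRt : Rᵀ * R = 1 := mul_eq_one_comm.1 hR
  have hsum : ∀ q' : Fin n × Bool,
      ∑ p, (R p q : ℂ) * (R p q' : ℂ) = if q = q' then 1 else 0 := by
    intro q'
    have h := congrFun (congrFun hRt q) q'
    simp only [Matrix.mul_apply, Matrix.transpose_apply, Matrix.one_apply] at h
    by_cases hqq : q = q'
    · rw [if_pos hqq] at h ⊢
      exact_mod_cast h
    · rw [if_neg hqq] at h ⊢
      exact_mod_cast h
  have key : U * (∑ p : Fin n × Bool, (R p q : ℂ) • majorana n p.1 p.2) * star U =
      majorana n q.1 q.2 := by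
    rw [Finset.mul_sum, Finset.sum_mul]
    simp_rw [Matrix.mul_smul, Matrix.smul_mul, hG, Finset.smul_sum, smul_smul]
    rw [Finset.sum_comm]
    simp_rw [← Finset.sum_smul, hsum, ite_smul, one_smul, zero_smul, Finset.sum_ite_eq,
      Finset.mem_univ, if_true]
  calc star U * majorana n q.1 q.2 * U
      = star U * (U * (∑ p : Fin n × Bool, (R p q : ℂ) • majorana n p.1 p.2) * star U) * U := by
        rw [key]
    _ = _ := star_mul_conj_mul_eq hU _

/-- **The Gaussian action on words**: if `U† c_q U = Σ_p R_{pq} c_p` for all `q`, then for every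
word `w = [q₁, …, q_m]`, `U† (c_{q₁} ⋯ c_{q_m}) U` lies in the span of the words of length `m`
(insert `U U† = 1` between the letters and expand).
[folklore] -/
private theorem star_mul_word_mul_mem_span {U : Matrix (QReg n) (QReg n) ℂ}
    (hU : U ∈ Matrix.unitaryGroup (QReg n) ℂ) {R : Matrix (Fin n × Bool) (Fin n × Bool) ℝ}
    (hq : ∀ q : Fin n × Bool, star U * majorana n q.1 q.2 * U =
      ∑ p : Fin n × Bool, (R p q : ℂ) • majorana n p.1 p.2) :
    ∀ w : List (Fin n × Bool), star U * (w.map fun q => majorana n q.1 q.2).prod * U ∈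
      Submodule.span ℂ {M : Matrix (QReg n) (QReg n) ℂ | ∃ w' : List (Fin n × Bool),
        w'.length = w.length ∧ (w'.map fun q => majorana n q.1 q.2).prod = M}
  | [] => by
    rw [List.map_nil, List.prod_nil, Matrix.mul_one, Unitary.star_mul_self_of_mem hU]
    exact Submodule.subset_span ⟨[], rfl, by rw [List.map_nil, List.prod_nil]⟩
  | q :: w => by
    have ih := star_mul_word_mul_mem_span hU hq w
    have hUU : U * star U = 1 := Matrix.mem_unitaryGroup_iff.1 hU
    rw [List.map_cons, List.prod_cons]
    have hins : star U * (majorana n q.1 q.2 * (w.map fun q => majorana n q.1 q.2).prod) * U =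
        (star U * majorana n q.1 q.2 * U) *
          (star U * (w.map fun q => majorana n q.1 q.2).prod * U) := by
      symm
      calc (star U * majorana n q.1 q.2 * U) * (star U * (w.map fun q => majorana n q.1 q.2).prod * U)
          = star U * majorana n q.1 q.2 * (U * star U) *
              (w.map fun q => majorana n q.1 q.2).prod * U := by
            simp only [Matrix.mul_assoc]
        _ = _ := by
            rw [hUU, Matrix.mul_one]
            simp only [Matrix.mul_assoc]
    rw [hins, hq q, Finset.sum_mul]
    refine Submodule.sum_mem _ fun p _ => ?_
    rw [Matrix.smul_mul]
    refine Submodule.smul_mem _ _ ?_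
    refine Submodule.span_induction (p := fun x _ => majorana n p.1 p.2 * x ∈
        Submodule.span ℂ {M : Matrix (QReg n) (QReg n) ℂ | ∃ w' : List (Fin n × Bool),
          w'.length = (q :: w).length ∧ (w'.map fun q => majorana n q.1 q.2).prod = M})
      ?_ ?_ ?_ ?_ ih
    · rintro x ⟨w', hw', rfl⟩
      refine Submodule.subset_span ⟨p :: w', by rw [List.length_cons, List.length_cons, hw'], ?_⟩
      rw [List.map_cons, List.prod_cons]
    · rw [Matrix.mul_zero]
      exact Submodule.zero_mem _
    · intro x y _ _ hx hy
      rw [Matrix.mul_add]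
      exact Submodule.add_mem _ hx hy
    · intro a x _ hx
      rw [Matrix.mul_smul]
      exact Submodule.smul_mem _ _ hx

/-! ### Bessel for a functional on the span of an orthogonal family -/

/-- Normalising an orthogonal family of common square norm `N`: `c • v` is orthonormal when
`c² N = 1` (`c` real).
[folklore] -/
private theorem orthonormal_smul_of_inner_eq {E : Type*} [NormedAddCommGroup E] [InnerProductSpace ℂ E]
    {α : Type*} [DecidableEq α] {N : ℝ} {c : ℝ} (v : α → E)
    (hv : ∀ i j, ⟪v i, v j⟫_ℂ = if i = j then (N : ℂ) else 0)
    (hcc : (c : ℂ) * (c : ℂ) * (N : ℂ) = 1) : Orthonormal ℂ (fun i => (c : ℂ) • v i) := by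
  rw [orthonormal_iff_ite]
  intro i j
  rw [inner_smul_left, inner_smul_right, hv, Complex.conj_ofReal]
  split_ifs
  · rw [← mul_assoc, hcc]
  · rw [mul_zero, mul_zero]

/-- **Bessel for a linear functional.** In a complex inner product space let `(u_i)_i` and
`(b_k)_k` be finite families with `⟪u_i, u_j⟫ = N δ_{ij}`, `⟪b_k, b_l⟫ = N δ_{kl}` (`N > 0`) and
every `u_i` in the span of the `b_k`.  Then `Σ_i |f(u_i)|² ≤ Σ_k |f(b_k)|²` for every linear
functional `f`.  (Normalise; `r = Σ_k conj(f b_k) b_k` represents `f` on the span; Bessel's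
inequality for the orthonormal `u` gives `Σ |⟪u_i, r⟫|² ≤ ‖r‖² = Σ |f b_k|²`.)
[folklore] -/
private theorem sum_norm_sq_le_of_mem_span {E : Type*} [NormedAddCommGroup E] [InnerProductSpace ℂ E]
    {ι κ : Type*} [Fintype ι] [Fintype κ] [DecidableEq ι] [DecidableEq κ]
    {N : ℝ} (hN : 0 < N) (u : ι → E) (b : κ → E)
    (hu : ∀ i j, ⟪u i, u j⟫_ℂ = if i = j then (N : ℂ) else 0)
    (hb : ∀ k l, ⟪b k, b l⟫_ℂ = if k = l then (N : ℂ) else 0)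
    (hmem : ∀ i, u i ∈ Submodule.span ℂ (Set.range b)) (f : E →ₗ[ℂ] ℂ) :
    ∑ i, ‖f (u i)‖ ^ 2 ≤ ∑ k, ‖f (b k)‖ ^ 2 := by
  -- normalisation
  set c : ℝ := (Real.sqrt N)⁻¹ with hc
  have hsq : Real.sqrt N * Real.sqrt N = N := Real.mul_self_sqrt hN.le
  have hc0 : 0 < c := inv_pos.2 (Real.sqrt_pos.2 hN)
  have hcc : (c : ℂ) * (c : ℂ) * (N : ℂ) = 1 := by
    have hs0 : Real.sqrt N ≠ 0 := (Real.sqrt_pos.2 hN).ne'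
    have : c * c * N = 1 := by
      calc c * c * N = c * c * (Real.sqrt N * Real.sqrt N) := by rw [hsq]
        _ = (c * Real.sqrt N) * (c * Real.sqrt N) := by ring
        _ = 1 := by rw [hc, inv_mul_cancel₀ hs0, one_mul]
    exact_mod_cast this
  have hcne : (c : ℂ) ≠ 0 := by exact_mod_cast hc0.ne'
  have hu' : Orthonormal ℂ (fun i => (c : ℂ) • u i) := orthonormal_smul_of_inner_eq u hu hcc
  have hb' : Orthonormal ℂ (fun k => (c : ℂ) • b k) := orthonormal_smul_of_inner_eq b hb hcc
  -- the Riesz representer of `f` on the span of the `b' k = c • b k`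
  set r : E := ∑ k, (starRingEnd ℂ) (f ((c : ℂ) • b k)) • ((c : ℂ) • b k) with hr
  have hrep : ∀ v ∈ Submodule.span ℂ (Set.range fun k => (c : ℂ) • b k), f v = ⟪r, v⟫_ℂ := by
    intro v hv
    induction hv using Submodule.span_induction with
    | mem x hx =>
      obtain ⟨k, rfl⟩ := hx
      rw [hr, hb'.inner_left_fintype, RingHomCompTriple.comp_apply, RingHom.id_apply]
    | zero => rw [map_zero, inner_zero_right]
    | add x y _ _ hx hy => rw [map_add, inner_add_right, hx, hy]
    | smul a x _ hx => rw [map_smul, inner_smul_right, hx, smul_eq_mul]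
  have hspan : Submodule.span ℂ (Set.range b) ≤ Submodule.span ℂ (Set.range fun k => (c : ℂ) • b k) := by
    rw [Submodule.span_le]
    rintro _ ⟨k, rfl⟩
    have : b k = (c : ℂ)⁻¹ • ((c : ℂ) • b k) := by
      rw [smul_smul, inv_mul_cancel₀ hcne, one_smul]
    rw [this]
    exact Submodule.smul_mem _ _ (Submodule.subset_span ⟨k, rfl⟩)
  have hmem' : ∀ i, (c : ℂ) • u i ∈ Submodule.span ℂ (Set.range fun k => (c : ℂ) • b k) :=
    fun i => Submodule.smul_mem _ _ (hspan (hmem i))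
  have hrmem : r ∈ Submodule.span ℂ (Set.range fun k => (c : ℂ) • b k) :=
    Submodule.sum_mem _ fun k _ => Submodule.smul_mem _ _ (Submodule.subset_span ⟨k, rfl⟩)
  -- Bessel
  have h1 : ∑ i, ‖f ((c : ℂ) • u i)‖ ^ 2 ≤ ‖r‖ ^ 2 := by
    calc ∑ i, ‖f ((c : ℂ) • u i)‖ ^ 2 = ∑ i, ‖⟪(c : ℂ) • u i, r⟫_ℂ‖ ^ 2 := by
          refine Finset.sum_congr rfl fun i _ => ?_
          rw [hrep _ (hmem' i), norm_inner_symm]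
      _ ≤ ‖r‖ ^ 2 := hu'.sum_inner_products_le r
  -- `‖r‖² = Σ |f b'_k|²`
  have h2 : ‖r‖ ^ 2 = ∑ k, ‖f ((c : ℂ) • b k)‖ ^ 2 := by
    have hfr : f r = ∑ k, (starRingEnd ℂ) (f ((c : ℂ) • b k)) * f ((c : ℂ) • b k) := by
      rw [hr, map_sum]
      simp only [map_smul, smul_eq_mul]
    rw [← inner_self_eq_norm_sq (𝕜 := ℂ), ← hrep r hrmem, hfr, map_sum]
    refine Finset.sum_congr rfl fun k _ => ?_
    rw [Complex.conj_mul', RCLike.re_to_complex]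
    norm_cast
  -- undo the normalisation
  have hscale : ∀ x : E, ‖f ((c : ℂ) • x)‖ ^ 2 = c ^ 2 * ‖f x‖ ^ 2 := by
    intro x
    rw [map_smul, smul_eq_mul, norm_mul, Complex.norm_real, Real.norm_of_nonneg hc0.le, mul_pow]
  simp only [hscale, ← Finset.mul_sum] at h1 h2
  rw [h2] at h1
  exact le_of_mul_le_mul_left h1 (pow_pos hc0 2)

/-! ### The Hilbert–Schmidt pairing in coordinates -/

/-- Through any coordinate identification `Φ` of `m × m` matrices with `EuclideanSpace ℂ (m × m)`,
the Euclidean inner product is the Hilbert–Schmidt pairing `⟪Φ A, Φ B⟫ = Tr(Aᴴ B)`.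
[folklore] -/
private theorem inner_eq_trace_of_apply {m : Type*} [Fintype m]
    (Φ : Matrix m m ℂ → EuclideanSpace ℂ (m × m)) (hΦ : ∀ A p, Φ A p = A p.1 p.2)
    (A B : Matrix m m ℂ) : ⟪Φ A, Φ B⟫_ℂ = (Aᴴ * B).trace := by
  rw [EuclideanSpace.inner_eq_star_dotProduct, dotProduct, Matrix.trace]
  simp only [Pi.star_apply, Matrix.diag_apply, Matrix.mul_apply, Matrix.conjTranspose_apply]
  rw [Fintype.sum_prod_type, Finset.sum_comm]
  refine Finset.sum_congr rfl fun y _ => Finset.sum_congr rfl fun x _ => ?_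
  rw [show (Φ B).ofLp (x, y) = Φ B (x, y) from rfl, show (Φ A).ofLp (x, y) = Φ A (x, y) from rfl,
    hΦ, hΦ, mul_comm]

/-- Hilbert–Schmidt orthogonality of the Pauli strings in coordinates: `⟪σ_S, σ_T⟫ = 2ⁿ δ_{ST}`. [folklore] -/
private theorem inner_pauliString (Φ : Matrix (QReg n) (QReg n) ℂ → EuclideanSpace ℂ (QReg n × QReg n))
    (hΦ : ∀ A p, Φ A p = A p.1 p.2) (S T : Fin n → Pauli) :
    ⟪Φ (pauliString S), Φ (pauliString T)⟫_ℂ = if S = T then (2 : ℂ) ^ n else 0 := by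
  rw [inner_eq_trace_of_apply Φ hΦ, conjTranspose_pauliString, trace_pauliString_mul_pauliString,
    Fintype.card_fin]

/-- Conjugation by a unitary preserves Hilbert–Schmidt orthogonality of the Pauli strings:
`⟪U† σ_S U, U† σ_T U⟫ = 2ⁿ δ_{ST}`.
[folklore] -/
private theorem inner_conj_pauliString {U : Matrix (QReg n) (QReg n) ℂ}
    (hU : U ∈ Matrix.unitaryGroup (QReg n) ℂ)
    (Φ : Matrix (QReg n) (QReg n) ℂ → EuclideanSpace ℂ (QReg n × QReg n))
    (hΦ : ∀ A p, Φ A p = A p.1 p.2) (S T : Fin n → Pauli) :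
    ⟪Φ (star U * pauliString S * U), Φ (star U * pauliString T * U)⟫_ℂ =
      if S = T then (2 : ℂ) ^ n else 0 := by
  have hUU : U * star U = 1 := Matrix.mem_unitaryGroup_iff.1 hU
  rw [inner_eq_trace_of_apply Φ hΦ]
  have h1 : (star U * pauliString S * U)ᴴ = star U * pauliString S * U := by
    rw [Matrix.conjTranspose_mul, Matrix.conjTranspose_mul, conjTranspose_pauliString,
      ← Matrix.star_eq_conjTranspose, ← Matrix.star_eq_conjTranspose, star_star, Matrix.mul_assoc]
  rw [h1]
  have h2 : star U * pauliString S * U * (star U * pauliString T * U) =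
      star U * (pauliString S * pauliString T) * U := by
    calc star U * pauliString S * U * (star U * pauliString T * U)
        = star U * pauliString S * (U * star U) * pauliString T * U := by
          simp only [Matrix.mul_assoc]
      _ = _ := by rw [hUU, Matrix.mul_one, Matrix.mul_assoc (star U)]
  rw [h2, Matrix.trace_mul_cycle, ← Matrix.mul_assoc, hUU, Matrix.one_mul,
    trace_pauliString_mul_pauliString, Fintype.card_fin]


end Bessel

section SpectralMass

/-! ### Source `SymplecticPurityGaussianDegreeBoundSpectralMass.lean` — purity of an initial block as a spectral mass

Original module docstring:

# `SymplecticPurity.GaussianDegreeBound` (stmt-QuantumAdvantage-9838) — III: purity is spectral mass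

Helper file (prover, `--supports stmt-QuantumAdvantage-9838`) for the support item
`GaussianDegreeBound` of route SymplecticPurity: the identity
`‖Σ⁽⁴⁾‖ = 2^{-k} Σ_{S ∈ 𝒫^{<k} ⊗ I} |⟨φ|S|φ⟩|²` ("purity of the cut `{wires < k}` = Pauli spectral
mass on the cut", Kempe–Regev–Unger–de Wolf Observation 3 + Parseval) for the LITERAL 4-fold
agreement sum `Σ⁽⁴⁾` through which the route's items write `Tr ρ²_{wires<k}(φ)`, for every vector
`φ` and every `k ≤ N`.  The proofs are those of §3 of the crux workfile
`Cruxes/CompositeFrameBound/Disproof.lean` (refuter-cdisprove-stmt-QuantumAdvantage-10730, gen 2),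
restated without its auxiliary definitions (`lowWires`, `expect`, `cutPurity`) so that the lemma
applies to the Theses decl verbatim: the completeness kernel of the Pauli strings on the low wires
(`gdb_sum_stringsOn_low_apply_mul_star_apply`) evaluated on arbitrary labels IS `2^k ·` the agreement
indicator.
-/


open Matrix Finset
open Literature.Computability.QuantumComplexity Literature.Computability.Cryptography

-- adapted from Summits/QuantumAdvantage/QuantumAdvantage/Cruxes/CompositeFrameBound/Disproof.lean §3

/-- Membership in the low wire set `{i : i < k}`. [folklore] -/
private theorem gdb_mem_filter_lt {N k : ℕ} {i : Fin N} :
    i ∈ (Finset.univ.filter fun i : Fin N => i.val < k) ↔ i.val < k := by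
  simp

/-- The low wire set `{i : i < k}` has `k` elements when `k ≤ N`. [folklore] -/
private theorem gdb_card_filter_lt {N k : ℕ} (hk : k ≤ N) :
    (Finset.univ.filter fun i : Fin N => i.val < k).card = k := by
  have : (Finset.univ.filter fun i : Fin N => i.val < k) = Finset.univ.map (Fin.castLEEmb hk) := by
    ext i
    simp only [Finset.mem_filter, Finset.mem_univ, true_and, Finset.mem_map]
    constructor
    · intro hi
      exact ⟨⟨i, hi⟩, Fin.ext rfl⟩
    · rintro ⟨j, rfl⟩
      exact j.2
  rw [this, Finset.card_map, Finset.card_univ, Fintype.card_fin]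

/-- A string on the low wires `{i : i < k}` is the identity on every wire `i` with `k ≤ i`. [folklore] -/
private theorem gdb_eq_I_of_mem_stringsOn_low {N k : ℕ} {S : Fin N → Pauli}
    (hS : S ∈ stringsOn (Finset.univ.filter fun i : Fin N => i.val < k)) (i : Fin N)
    (hi : k ≤ i.val) : S i = Pauli.I :=
  mem_stringsOn.1 hS i fun h => absurd (gdb_mem_filter_lt.1 h) (not_lt.2 hi)

/-- **Entrywise completeness of the strings on the low wires, for ARBITRARY labels**:
`Σ_{S ∈ 𝒫^{<k} ⊗ I} S_{x₂x₁} conj(S_{x₃x₄}) = 2^k · [the four agreement conditions]`.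
[folklore] -/
private theorem gdb_sum_stringsOn_low_apply_mul_star_apply {N k : ℕ} (hk : k ≤ N)
    (x₁ x₂ x₃ x₄ : QReg N) :
    ∑ S ∈ stringsOn (Finset.univ.filter fun i : Fin N => i.val < k),
        pauliString S x₂ x₁ * star (pauliString S x₃ x₄) =
      if (∀ i, k ≤ i.val → x₁ i = x₂ i) ∧ (∀ i, i.val < k → x₂ i = x₃ i) ∧
          (∀ i, k ≤ i.val → x₃ i = x₄ i) ∧ (∀ i, i.val < k → x₄ i = x₁ i)
      then (2 : ℂ) ^ k else 0 := by
  have hstar : ∀ S : Fin N → Pauli, star (pauliString S x₃ x₄) = pauliString S x₄ x₃ :=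
    fun S => by
      have := congrFun (congrFun (conjTranspose_pauliString S) x₄) x₃
      rwa [Matrix.conjTranspose_apply] at this
  simp only [hstar]
  simp only [pauliString_eq, tensorAll_apply, ← Finset.prod_mul_distrib, stringsOn]
  rw [← Finset.prod_univ_sum (fun i => if i ∈ (Finset.univ.filter fun i : Fin N => i.val < k)
      then Finset.univ else {Pauli.I})
    (fun i Q => Pauli.mat Q (x₂ i) (x₁ i) * Pauli.mat Q (x₄ i) (x₃ i))]
  have key : ∀ i : Fin N, (∑ Q ∈ (if i ∈ (Finset.univ.filter fun i : Fin N => i.val < k)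
      then Finset.univ else {Pauli.I}),
      Pauli.mat Q (x₂ i) (x₁ i) * Pauli.mat Q (x₄ i) (x₃ i)) =
      if (k ≤ i.val → x₂ i = x₁ i ∧ x₄ i = x₃ i) ∧ (i.val < k → x₂ i = x₃ i ∧ x₁ i = x₄ i)
      then (if i.val < k then 2 else 1) else 0 := by
    intro i
    by_cases hi : i.val < k
    · have hi' : ¬ k ≤ i.val := not_le.mpr hi
      rw [if_pos (gdb_mem_filter_lt.mpr hi), Pauli.sum_mat_mul_mat]
      simp only [hi', false_implies, true_and, hi, true_implies, if_true]
    · have hi' : k ≤ i.val := not_lt.mp hi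
      rw [if_neg (fun h => hi (gdb_mem_filter_lt.mp h)), Finset.sum_singleton]
      simp only [Pauli.mat_I_apply, hi', true_implies, hi, false_implies, and_true, if_false]
      by_cases h1 : x₂ i = x₁ i <;> by_cases h2 : x₄ i = x₃ i <;> simp [h1, h2]
  simp only [key, Fintype.prod_ite_zero]
  have hprod : (∏ i : Fin N, (if i.val < k then (2 : ℂ) else 1)) = 2 ^ k := by
    rw [Finset.prod_ite, Finset.prod_const_one, mul_one, Finset.prod_const]
    congr 1
    exact gdb_card_filter_lt hk
  rw [hprod]
  by_cases h : (∀ i, k ≤ i.val → x₁ i = x₂ i) ∧ (∀ i, i.val < k → x₂ i = x₃ i) ∧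
      (∀ i, k ≤ i.val → x₃ i = x₄ i) ∧ (∀ i, i.val < k → x₄ i = x₁ i)
  · rw [if_pos h, if_pos]
    intro i
    exact ⟨fun hi => ⟨(h.1 i hi).symm, (h.2.2.1 i hi).symm⟩,
      fun hi => ⟨h.2.1 i hi, (h.2.2.2 i hi).symm⟩⟩
  · rw [if_neg h, if_neg]
    intro h'
    exact h ⟨fun i hi => ((h' i).1 hi).1.symm, fun i hi => ((h' i).2 hi).1,
      fun i hi => ((h' i).1 hi).2.symm, fun i hi => ((h' i).2 hi).2.symm⟩

/-- Expansion of a Pauli expectation `⟨φ|S|φ⟩` into matrix entries. [folklore] -/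
private theorem gdb_star_dotProduct_pauliString_mulVec {N : ℕ} (φ : QReg N → ℂ) (S : Fin N → Pauli) :
    star φ ⬝ᵥ (pauliString S *ᵥ φ) = ∑ a, ∑ b, star (φ a) * (pauliString S a b * φ b) := by
  simp only [dotProduct, Matrix.mulVec, Pi.star_apply, Finset.mul_sum]

/-- **Purity = spectral mass on the cut** (4-fold-sum form): `2^k ·` (the 4-fold agreement sum of
`φ` at the cut `k`) `= Σ_{S ∈ 𝒫^{<k} ⊗ I} ⟨φ|S|φ⟩ · conj ⟨φ|S|φ⟩`, for every vector `φ` and `k ≤ N`.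
[folklore] -/
private theorem gdb_two_pow_mul_cutSum {N : ℕ} (φ : QReg N → ℂ) {k : ℕ} (hk : k ≤ N) :
    (2 : ℂ) ^ k * ∑ x₁ : QReg N, ∑ x₂ : QReg N, ∑ x₃ : QReg N, ∑ x₄ : QReg N,
      (if (∀ i, k ≤ i.val → x₁ i = x₂ i) ∧ (∀ i, i.val < k → x₂ i = x₃ i) ∧
          (∀ i, k ≤ i.val → x₃ i = x₄ i) ∧ (∀ i, i.val < k → x₄ i = x₁ i)
        then φ x₁ * star (φ x₂) * φ x₃ * star (φ x₄) else 0) =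
      ∑ S ∈ stringsOn (Finset.univ.filter fun i : Fin N => i.val < k),
        (star φ ⬝ᵥ (pauliString S *ᵥ φ)) * star (star φ ⬝ᵥ (pauliString S *ᵥ φ)) := by
  have lhs : (2 : ℂ) ^ k * ∑ x₁ : QReg N, ∑ x₂ : QReg N, ∑ x₃ : QReg N, ∑ x₄ : QReg N,
      (if (∀ i, k ≤ i.val → x₁ i = x₂ i) ∧ (∀ i, i.val < k → x₂ i = x₃ i) ∧
          (∀ i, k ≤ i.val → x₃ i = x₄ i) ∧ (∀ i, i.val < k → x₄ i = x₁ i)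
        then φ x₁ * star (φ x₂) * φ x₃ * star (φ x₄) else 0) = ∑ x₁, ∑ x₂, ∑ x₃, ∑ x₄,
      star (φ x₂) * φ x₁ * (φ x₃ * star (φ x₄)) *
        (if (∀ i, k ≤ i.val → x₁ i = x₂ i) ∧ (∀ i, i.val < k → x₂ i = x₃ i) ∧
            (∀ i, k ≤ i.val → x₃ i = x₄ i) ∧ (∀ i, i.val < k → x₄ i = x₁ i)
          then (2 : ℂ) ^ k else 0) := by
    simp only [Finset.mul_sum]
    refine Finset.sum_congr rfl fun x₁ _ => Finset.sum_congr rfl fun x₂ _ =>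
      Finset.sum_congr rfl fun x₃ _ => Finset.sum_congr rfl fun x₄ _ => ?_
    split_ifs <;> ring
  have rhs : ∀ S : Fin N → Pauli,
      (star φ ⬝ᵥ (pauliString S *ᵥ φ)) * star (star φ ⬝ᵥ (pauliString S *ᵥ φ)) =
      ∑ x₂, ∑ x₁, ∑ x₃, ∑ x₄, star (φ x₂) * φ x₁ * (φ x₃ * star (φ x₄)) *
        (pauliString S x₂ x₁ * star (pauliString S x₃ x₄)) := by
    intro S
    rw [gdb_star_dotProduct_pauliString_mulVec]
    simp only [star_sum, star_mul', star_star, Finset.sum_mul_sum]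
    refine Finset.sum_congr rfl fun x₂ _ => ?_
    rw [Finset.sum_comm]
    refine Finset.sum_congr rfl fun x₁ _ => Finset.sum_congr rfl fun x₃ _ =>
      Finset.sum_congr rfl fun x₄ _ => ?_
    ring
  rw [lhs, Finset.sum_congr rfl fun S _ => rhs S]
  conv_lhs => rw [Finset.sum_comm]
  conv_rhs => rw [Finset.sum_comm]
  refine Finset.sum_congr rfl fun x₂ _ => ?_
  conv_rhs => rw [Finset.sum_comm]
  refine Finset.sum_congr rfl fun x₁ _ => ?_
  conv_rhs => rw [Finset.sum_comm]
  refine Finset.sum_congr rfl fun x₃ _ => ?_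
  conv_rhs => rw [Finset.sum_comm]
  refine Finset.sum_congr rfl fun x₄ _ => ?_
  rw [← Finset.mul_sum, gdb_sum_stringsOn_low_apply_mul_star_apply hk]

/-- **Purity = spectral mass on the cut** (norm form): the norm of the 4-fold agreement sum of `φ`
at the cut `k ≤ N` equals `2^{-k} Σ_{S ∈ 𝒫^{<k} ⊗ I} |⟨φ|S|φ⟩|²`.
[folklore] -/
private theorem gdb_norm_cutSum_eq {N : ℕ} (φ : QReg N → ℂ) {k : ℕ} (hk : k ≤ N) :
    ‖∑ x₁ : QReg N, ∑ x₂ : QReg N, ∑ x₃ : QReg N, ∑ x₄ : QReg N,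
      (if (∀ i, k ≤ i.val → x₁ i = x₂ i) ∧ (∀ i, i.val < k → x₂ i = x₃ i) ∧
          (∀ i, k ≤ i.val → x₃ i = x₄ i) ∧ (∀ i, i.val < k → x₄ i = x₁ i)
        then φ x₁ * star (φ x₂) * φ x₃ * star (φ x₄) else 0)‖ =
      ((2 : ℝ) ^ k)⁻¹ * ∑ S ∈ stringsOn (Finset.univ.filter fun i : Fin N => i.val < k),
        ‖star φ ⬝ᵥ (pauliString S *ᵥ φ)‖ ^ 2 := by
  have h := gdb_two_pow_mul_cutSum φ hk
  set P := ∑ x₁ : QReg N, ∑ x₂ : QReg N, ∑ x₃ : QReg N, ∑ x₄ : QReg N,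
      (if (∀ i, k ≤ i.val → x₁ i = x₂ i) ∧ (∀ i, i.val < k → x₂ i = x₃ i) ∧
          (∀ i, k ≤ i.val → x₃ i = x₄ i) ∧ (∀ i, i.val < k → x₄ i = x₁ i)
        then φ x₁ * star (φ x₂) * φ x₃ * star (φ x₄) else 0) with hP
  have h2 : P = ((2 : ℂ) ^ k)⁻¹ * ∑ S ∈ stringsOn (Finset.univ.filter fun i : Fin N => i.val < k),
      (star φ ⬝ᵥ (pauliString S *ᵥ φ)) * star (star φ ⬝ᵥ (pauliString S *ᵥ φ)) := by
    rw [← h, ← mul_assoc, inv_mul_cancel₀ (pow_ne_zero _ two_ne_zero), one_mul]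
  have h3 : ∀ S : Fin N → Pauli,
      (star φ ⬝ᵥ (pauliString S *ᵥ φ)) * star (star φ ⬝ᵥ (pauliString S *ᵥ φ)) =
        ((‖star φ ⬝ᵥ (pauliString S *ᵥ φ)‖ ^ 2 : ℝ) : ℂ) := by
    intro S
    rw [Complex.star_def, Complex.mul_conj, Complex.normSq_eq_norm_sq, Complex.ofReal_pow]
  rw [h2]
  simp only [h3]
  rw [← Complex.ofReal_sum]
  rw [norm_mul, norm_inv, norm_pow, Complex.norm_ofNat, Complex.norm_real, Real.norm_eq_abs,
    abs_of_nonneg (Finset.sum_nonneg fun S _ => sq_nonneg _)]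


end SpectralMass

section Main

/-! ### Source `SymplecticPurityGaussianDegreeBound.lean` — the closing file

Original module docstring:

# `SymplecticPurity.GaussianDegreeBound` (stmt-QuantumAdvantage-9838) — MATCHGATE FRAMES

PROOF of the support item `GaussianDegreeBound` of route SymplecticPurity (post-crux prover,
2026-08-16): for a unit `ε`-flat vector `ψ` on `n` qubits (`|⟨ψ|S|ψ⟩| ≤ ε` for every Pauli string
`S ≠ I`), every unitary `U` that is fermionic Gaussian in the tree's Jordan–Wigner frame
(`U c_p U† = Σ_q R_{pq} c_q`, `R Rᵀ = 1`, `c = majorana`) and every `d ≤ n`, the purity of the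
first `d` qubits of `Uψ` (the Theses decl's literal 4-fold agreement sum) is at most
`2^{-d} (1 + ε² Σ_{k=1}^{2d} C(2n,k))`.

## Proof (filtration + Bessel; no compound matrices)
1. purity = spectral mass: `‖Σ⁽⁴⁾‖ = 2^{-d} Σ_{S ∈ 𝒫^{<d}⊗I} |⟨Uψ|S|Uψ⟩|²` (`gdb_norm_cutSum_eq`, file
   `…SpectralMass`), and `⟨Uψ|S|Uψ⟩ = ⟨ψ|U†SU|ψ⟩`.
2. Jordan–Wigner keeps initial blocks local: each such `S` is a unit phase times a Majorana WORD of
   length `≤ 2d` (`exists_word_of_low`, file `…Words`).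
3. `U† c_q U = Σ_p R_{pq} c_p`, so `U†` maps words of length `m` into the span of words of length `m`
   (`star_mul_word_mul_mem_span`, file `…Bessel`); every word is a unit phase times the Pauli string
   of the SET of its odd-multiplicity letters (`word_eq_smul_pauliString`,
   `exists_finset_sum_eq_list_sum`), so all `U† S U` lie in the span of the strings `σ_T`, `T` ranging
   over a set `𝒯` of strings with `|𝒯 ∖ {I}| ≤ Σ_{k=1}^{2d} C(2n,k)` (`card_image_erase_le`).
4. The `U† S U` are Hilbert–Schmidt orthogonal (norm² `2ⁿ`), as are the `σ_T`; Bessel for the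
   functional `A ↦ ⟨ψ|A|ψ⟩` (`sum_norm_sq_le_of_mem_span`) gives
   `Σ_S |⟨ψ|U†SU|ψ⟩|² ≤ Σ_{T ∈ 𝒯} |⟨ψ|σ_T|ψ⟩|² ≤ 1 + ε² |𝒯 ∖ {I}|`.
-/


open Matrix Finset
open scoped InnerProductSpace
open Literature.Computability.QuantumComplexity Literature.Computability.Cryptography

/-- Expectations transform covariantly: `⟨Uχ|S|Uχ⟩ = ⟨χ|U† S U|χ⟩`. [folklore] -/
private theorem gdb_star_mulVec_dotProduct_pauliString_mulVec {n : ℕ} (U : Matrix (QReg n) (QReg n) ℂ)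
    (χ : QReg n → ℂ) (S : Fin n → Pauli) :
    star (U *ᵥ χ) ⬝ᵥ (pauliString S *ᵥ (U *ᵥ χ)) = star χ ⬝ᵥ ((star U * pauliString S * U) *ᵥ χ) := by
  rw [Matrix.star_mulVec, ← Matrix.dotProduct_mulVec, Matrix.mulVec_mulVec, Matrix.mulVec_mulVec,
    ← Matrix.star_eq_conjTranspose, Matrix.mul_assoc]

/-- The expectation of the identity string in a unit vector is `1` in norm:
`|⟨ψ|I|ψ⟩|² = 1` when `normSq ψ = 1`.
[folklore] -/
private theorem gdb_norm_star_dotProduct_one_mulVec {n : ℕ} {ψ : QReg n → ℂ} (hψ : normSq ψ = 1) :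
    ‖star ψ ⬝ᵥ (pauliString (fun _ : Fin n => Pauli.I) *ᵥ ψ)‖ ^ 2 = 1 := by
  rw [pauliString_const_I, Matrix.one_mulVec]
  have h : star ψ ⬝ᵥ ψ = ((normSq ψ : ℝ) : ℂ) := by
    rw [normSq, Complex.ofReal_sum, dotProduct]
    refine Finset.sum_congr rfl fun x _ => ?_
    rw [Pi.star_apply, Complex.star_def, Complex.conj_mul', Complex.ofReal_pow]
  rw [h, hψ, Complex.ofReal_one, norm_one, one_pow]

/-- Flatness bound on a set of strings: for a unit `ε`-flat `ψ` and any finite set `𝒯` of strings,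
`Σ_{T ∈ 𝒯} |⟨ψ|σ_T|ψ⟩|² ≤ 1 + ε² · |𝒯 ∖ {I}|`.
[folklore] -/
private theorem gdb_sum_norm_sq_le_one_add {n : ℕ} {ε : ℝ} {ψ : QReg n → ℂ} (hψ : normSq ψ = 1)
    (hflat : ∀ S : Fin n → Pauli, S ≠ (fun _ => Pauli.I) → ‖star ψ ⬝ᵥ (pauliString S *ᵥ ψ)‖ ≤ ε)
    (𝒯 : Finset (Fin n → Pauli)) :
    ∑ T ∈ 𝒯, ‖star ψ ⬝ᵥ (pauliString T *ᵥ ψ)‖ ^ 2 ≤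
      1 + ε ^ 2 * ((𝒯.erase (fun _ => Pauli.I)).card : ℝ) := by
  classical
  have hrest : ∑ T ∈ 𝒯.erase (fun _ => Pauli.I), ‖star ψ ⬝ᵥ (pauliString T *ᵥ ψ)‖ ^ 2 ≤
      ε ^ 2 * ((𝒯.erase (fun _ => Pauli.I)).card : ℝ) := by
    rw [mul_comm]
    have h := Finset.sum_le_card_nsmul (𝒯.erase (fun _ => Pauli.I))
      (fun T => ‖star ψ ⬝ᵥ (pauliString T *ᵥ ψ)‖ ^ 2) (ε ^ 2) (fun T hT => by
        have hne : T ≠ fun _ => Pauli.I := (Finset.mem_erase.1 hT).1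
        exact pow_le_pow_left₀ (norm_nonneg _) (hflat T hne) 2)
    rwa [nsmul_eq_mul] at h
  by_cases hI : (fun _ => Pauli.I) ∈ 𝒯
  · rw [← Finset.add_sum_erase 𝒯 _ hI, gdb_norm_star_dotProduct_one_mulVec hψ]
    linarith
  · have he : 𝒯.erase (fun _ => Pauli.I) = 𝒯 := Finset.erase_eq_of_notMem hI
    rw [he] at hrest ⊢
    linarith


end Main

end GaussianDegreeBound

/-! ### The named fact -/

open GaussianDegreeBound in
/-- **`gaussianDegreeBound` — DISCHARGED** (matchgate frames do not compress flat states): for a unit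
`ε`-flat `ψ` on `n` qubits, every fermionic Gaussian unitary `U` (`U c_p U† = Σ_q R_{pq} c_q`, `R Rᵀ = 1`)
and every `d ≤ n`, the block `{wires < d}` of `Uψ` has purity `≤ (1 + ε² Σ_{k=1}^{2d} C(2n,k)) / 2^d`.
[cite: JozsaMiyake2008] -/
theorem gaussianDegreeBound_holds : gaussianDegreeBound := by
  intro n ε ψ hψ hflat U hU hGauss d hd
  classical
  obtain ⟨R, hR, hG⟩ := hGauss
  -- Step 1: purity = spectral mass; reduce to a bound on the spectral mass of `Uψ` on the cut
  rw [gdb_norm_cutSum_eq (U *ᵥ ψ) hd, div_eq_inv_mul]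
  refine mul_le_mul_of_nonneg_left ?_ (inv_nonneg.2 (pow_nonneg zero_le_two d))
  -- notation
  set L : Finset (Fin n → Pauli) := stringsOn (Finset.univ.filter fun i : Fin n => i.val < d) with hL
  -- the bit encoding of the Pauli letters (strings are a group modulo phases)
  set β : Pauli → ZMod 2 × ZMod 2 := fun P =>
    ((if P = Pauli.X ∨ P = Pauli.Y then 1 else 0), (if P = Pauli.Z ∨ P = Pauli.Y then 1 else 0)) with hβ
  set π : ZMod 2 × ZMod 2 → Pauli := fun v =>
    if v = (0, 0) then Pauli.I else if v = (1, 0) then Pauli.X else if v = (1, 1) then Pauli.Y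
      else Pauli.Z with hπ
  have hπβ : ∀ P, π (β P) = P := by intro P; cases P <;> decide
  have hβπ : ∀ v, β (π v) = v := by decide
  have hmul : ∀ P Q : Pauli, β (P.letterMul Q) = β P + β Q := by
    intro P Q; cases P <;> cases Q <;> decide
  have hβI : β Pauli.I = 0 := by decide
  have h2 : ∀ x : Fin n → ZMod 2 × ZMod 2, x + x = 0 := fun x =>
    funext fun i => (by decide : ∀ v : ZMod 2 × ZMod 2, v + v = 0) (x i)
  -- the set of strings carrying all conjugated low strings
  set G : Finset (Fin n × Bool) → (Fin n → Pauli) := fun T i =>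
    π (∑ q ∈ T, β (majoranaWord n q.1 q.2 i)) with hGdef
  set 𝒯 : Finset (Fin n → Pauli) :=
    ((Finset.univ : Finset (Finset (Fin n × Bool))).filter (fun T => T.card ≤ 2 * d)).image G
    with h𝒯
  have hG0 : G ∅ = fun _ => Pauli.I := by
    funext i
    simp only [hGdef, Finset.sum_empty]
    rw [← hβI, hπβ]
  -- Step 2–3: every `U† σ_S U`, `S` low, lies in the span of the strings of `𝒯`
  have hq := star_mul_majorana_mul hU hR hG
  have hmemM : ∀ S ∈ L, star U * pauliString S * U ∈
      Submodule.span ℂ (pauliString '' (↑𝒯 : Set (Fin n → Pauli))) := by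
    intro S hS
    obtain ⟨w, c, hw, -, hSw⟩ := exists_word_of_low hd S (fun i hi => gdb_eq_I_of_mem_stringsOn_low hS i hi)
    rw [hSw, Matrix.mul_smul, Matrix.smul_mul]
    refine Submodule.smul_mem _ _ ((Submodule.span_le.2 ?_) (star_mul_word_mul_mem_span hU hq w))
    rintro _ ⟨w', hw', rfl⟩
    obtain ⟨c', -, hw'eq⟩ := word_eq_smul_pauliString β π hπβ hβπ hmul hβI w'
    rw [hw'eq]
    refine Submodule.smul_mem _ _ (Submodule.subset_span ⟨_, ?_, rfl⟩)
    obtain ⟨T, hTcard, hTsum⟩ := exists_finset_sum_eq_list_sum h2 w'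
    have hGT : (fun i => π ((w'.map fun q => fun i => β (majoranaWord n q.1 q.2 i)).sum i)) = G T := by
      funext i
      rw [hTsum, Finset.sum_apply]
    rw [hGT, Finset.mem_coe, h𝒯]
    refine Finset.mem_image_of_mem G (Finset.mem_filter.2 ⟨Finset.mem_univ _, ?_⟩)
    rw [hw'] at hTcard
    exact hTcard.trans hw
  -- Step 4: Bessel in `EuclideanSpace ℂ (QReg n × QReg n)`
  set Φ : Matrix (QReg n) (QReg n) ℂ ≃ₗ[ℂ] EuclideanSpace ℂ (QReg n × QReg n) :=
    (LinearEquiv.curry ℂ ℂ (QReg n) (QReg n)).symm ≪≫ₗ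
      (WithLp.linearEquiv 2 ℂ (QReg n × QReg n → ℂ)).symm with hΦdef
  have hΦ : ∀ (A : Matrix (QReg n) (QReg n) ℂ) (p : QReg n × QReg n), Φ A p = A p.1 p.2 :=
    fun _ _ => rfl
  set fM : Matrix (QReg n) (QReg n) ℂ →ₗ[ℂ] ℂ :=
    { toFun := fun A => star ψ ⬝ᵥ (A *ᵥ ψ)
      map_add' := fun A B => by rw [Matrix.add_mulVec, dotProduct_add]
      map_smul' := fun c A => by rw [Matrix.smul_mulVec, dotProduct_smul, RingHom.id_apply] }
    with hfM
  have hfM_apply : ∀ A, fM A = star ψ ⬝ᵥ (A *ᵥ ψ) := fun _ => rfl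
  set f : EuclideanSpace ℂ (QReg n × QReg n) →ₗ[ℂ] ℂ := fM ∘ₗ Φ.symm.toLinearMap with hf
  have hfΦ : ∀ A, f (Φ A) = star ψ ⬝ᵥ (A *ᵥ ψ) := fun A => by
    rw [hf, LinearMap.comp_apply, LinearEquiv.coe_toLinearMap, LinearEquiv.symm_apply_apply]
    exact hfM_apply A
  set u : ↥L → EuclideanSpace ℂ (QReg n × QReg n) := fun S => Φ (star U * pauliString S * U) with hu
  set b : ↥𝒯 → EuclideanSpace ℂ (QReg n × QReg n) := fun T => Φ (pauliString T) with hb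
  have hN : (0 : ℝ) < (2 : ℝ) ^ n := by positivity
  have huo : ∀ i j : ↥L, ⟪u i, u j⟫_ℂ = if i = j then (((2 : ℝ) ^ n : ℝ) : ℂ) else 0 := by
    intro i j
    rw [hu, inner_conj_pauliString hU Φ hΦ]
    push_cast
    by_cases h : i = j
    · rw [if_pos h, if_pos (congrArg Subtype.val h)]
    · rw [if_neg h, if_neg (fun h' => h (Subtype.ext h'))]
  have hbo : ∀ k l : ↥𝒯, ⟪b k, b l⟫_ℂ = if k = l then (((2 : ℝ) ^ n : ℝ) : ℂ) else 0 := by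
    intro k l
    rw [hb, inner_pauliString Φ hΦ]
    push_cast
    by_cases h : k = l
    · rw [if_pos h, if_pos (congrArg Subtype.val h)]
    · rw [if_neg h, if_neg (fun h' => h (Subtype.ext h'))]
  have hmem : ∀ i : ↥L, u i ∈ Submodule.span ℂ (Set.range b) := by
    intro i
    have h1 : Φ (star U * pauliString i * U) ∈
        (Submodule.span ℂ (pauliString '' (↑𝒯 : Set (Fin n → Pauli)))).map Φ.toLinearMap :=
      Submodule.mem_map_of_mem (hmemM i i.2)
    rw [Submodule.map_span] at h1
    refine Submodule.span_mono ?_ h1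
    rintro _ ⟨_, ⟨T, hT, rfl⟩, rfl⟩
    exact ⟨⟨T, hT⟩, rfl⟩
  have bessel := sum_norm_sq_le_of_mem_span hN u b huo hbo hmem f
  -- assemble
  calc ∑ S ∈ L, ‖star (U *ᵥ ψ) ⬝ᵥ (pauliString S *ᵥ (U *ᵥ ψ))‖ ^ 2
      = ∑ i : ↥L, ‖f (u i)‖ ^ 2 := by
        rw [← Finset.sum_coe_sort]
        refine Finset.sum_congr rfl fun i _ => ?_
        rw [gdb_star_mulVec_dotProduct_pauliString_mulVec, hu, hfΦ]
    _ ≤ ∑ k : ↥𝒯, ‖f (b k)‖ ^ 2 := bessel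
    _ = ∑ T ∈ 𝒯, ‖star ψ ⬝ᵥ (pauliString T *ᵥ ψ)‖ ^ 2 := by
        rw [← Finset.sum_coe_sort 𝒯]
        refine Finset.sum_congr rfl fun k _ => ?_
        rw [hb, hfΦ]
    _ ≤ 1 + ε ^ 2 * ((𝒯.erase (fun _ => Pauli.I)).card : ℝ) := gdb_sum_norm_sq_le_one_add hψ hflat 𝒯
    _ ≤ 1 + ε ^ 2 * ∑ k ∈ Finset.Icc 1 (2 * d), ((2 * n).choose k : ℝ) := by
        have hc := card_image_erase_le n (2 * d) G
        rw [hG0] at hc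
        have hc' : (((𝒯.erase (fun _ => Pauli.I)).card : ℕ) : ℝ) ≤
            ((∑ k ∈ Finset.Icc 1 (2 * d), (2 * n).choose k : ℕ) : ℝ) := by
          rw [h𝒯]; exact_mod_cast hc
        push_cast at hc'
        nlinarith [sq_nonneg ε]


end Literature.Barriers.QuantumAdvantage

end
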